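import Literature.MathematicalPhysics.QuantumManyBody.JelliumBoseGasCondensateDilation
import Literature.Analysis.Calculus.PolarCoordinatesE3
import HarnessLib

/-!
# Inserting one particle: the Jastrow volume, scale covariance, and cancelling the mass

Topic `Literature/MathematicalPhysics/QuantumManyBody` (grouping namespace `BoseGas`; carriers
of `BoseEinsteinCondensation.lean`, dilations of `JelliumBoseGasDilation.lean`). Three elementary
ingredients of an insertion bound `E₀(N+1, L) ≤ E₀(N, L) + A/L² + B·N·R₀/L³` for the Dirichlet
ground-state energy of `N` bosons with a repulsive pair potential of range `R₀` (chemical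
potential at low density; crux `RigidMomentumBound` of
`AtomisticToContinuum/BoseEinsteinCondensation`):

* `InsertionScaling.lintegral_deficiency_le` — the **Jastrow volume** of the exponential profile
  `f(z) = 1 - (1 + (‖z‖-R)₊) e^{-(‖z‖-R)₊}` (`C¹`, `f = 0` on the ball of radius `R`,
  `‖∇f‖ ≤ 1 - f`): `∫_{ℝ³} (1 - f) ≤ 4π (R³/3 + 2R² + 6R + 8)` (polar coordinates
  `Literature.Analysis.Calculus.lintegral_radial_eq`; core ball plus an explicit
  antiderivative `-e^{-(r-R)} P_R(r-R)` for the tail; it is an equality);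
* `InsertionScaling.insertionBound_of_fixedRange` — **scale covariance**: such a bound for
  all measurable potentials of ONE range `c` implies it for every range `R₀`, by the exact
  dilation covariance `E₀(s⁻²v(·/s), N, sL) = s⁻² E₀(v, N, L)`
  (`JelliumBoseGas.groundStateEnergy_dilate`);
* `InsertionScaling.final_bound`, `final_bound_real` — **cancelling the mass** in `ℝ≥0∞`:
  from `E₁ M ≤ E M + c + 9w`, `1 ≤ M + 2w`, `M ≤ 1`, `w ≤ w₀ < 1/2`:
  `E₁ ≤ E + (c + 9w₀)/(1 - 2w₀)`.

No definitions; tagged folklore.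
-/

noncomputable section

namespace Literature.MathematicalPhysics.QuantumManyBody.BoseGas

open _root_.MeasureTheory _root_.Filter _root_.Set _root_.Real _root_.Metric
open scoped ENNReal NNReal Topology

namespace InsertionScaling

/-! ### The deficiency integral of the exponential Jastrow profile -/

/-- The antiderivative `G_R(r) = -e^{-(r-R)} P_R(r-R)`, `P_R(s) = s³ + (2R+4)s² + (R²+6R+8)s +
(2R²+6R+8)` (so that `P_R - P_R' = (1+s)(s+R)²`), of `(1 + (r-R)) e^{-(r-R)} r²`. [folklore] -/
theorem hasDerivAt_tailPrim (R r : ℝ) :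
    HasDerivAt (fun r => -(exp (-(r - R)) * ((r - R) ^ 3 + (2 * R + 4) * (r - R) ^ 2 +
      (R ^ 2 + 6 * R + 8) * (r - R) + (2 * R ^ 2 + 6 * R + 8))))
      ((1 + (r - R)) * exp (-(r - R)) * r ^ 2) r := by
  have hs : HasDerivAt (fun r : ℝ => r - R) 1 r := (hasDerivAt_id' r).sub_const R
  have he : HasDerivAt (fun r : ℝ => exp (-(r - R))) (exp (-(r - R)) * -1) r := by
    simpa using hs.neg.exp
  have hp : HasDerivAt (fun r : ℝ => (r - R) ^ 3 + (2 * R + 4) * (r - R) ^ 2 +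
      (R ^ 2 + 6 * R + 8) * (r - R) + (2 * R ^ 2 + 6 * R + 8))
      (3 * (r - R) ^ 2 * 1 + (2 * R + 4) * (2 * (r - R) * 1) + (R ^ 2 + 6 * R + 8) * 1) r := by
    have h3 := hs.pow 3
    have h2 := (hs.pow 2).const_mul (2 * R + 4)
    have h1 := hs.const_mul (R ^ 2 + 6 * R + 8)
    have h := ((h3.add h2).add h1).add_const (2 * R ^ 2 + 6 * R + 8)
    refine h.congr_deriv ?_
    simp
  refine ((he.mul hp).neg).congr_deriv ?_
  ring

/-- `G_R(r) → 0` as `r → ∞` (`sⁿ e^{-s} → 0`). [folklore] -/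
theorem tendsto_tailPrim (R : ℝ) :
    Tendsto (fun r => -(exp (-(r - R)) * ((r - R) ^ 3 + (2 * R + 4) * (r - R) ^ 2 +
      (R ^ 2 + 6 * R + 8) * (r - R) + (2 * R ^ 2 + 6 * R + 8)))) atTop (𝓝 0) := by
  have hshift : Tendsto (fun r : ℝ => r - R) atTop atTop :=
    tendsto_atTop_add_const_right _ _ tendsto_id
  have hn : ∀ n : ℕ, Tendsto (fun r : ℝ => (r - R) ^ n * exp (-(r - R))) atTop (𝓝 0) :=
    fun n => (tendsto_pow_mul_exp_neg_atTop_nhds_zero n).comp hshift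
  have h : Tendsto (fun r : ℝ => -((r - R) ^ 3 * exp (-(r - R)) +
      (2 * R + 4) * ((r - R) ^ 2 * exp (-(r - R))) +
      (R ^ 2 + 6 * R + 8) * ((r - R) ^ 1 * exp (-(r - R))) +
      (2 * R ^ 2 + 6 * R + 8) * ((r - R) ^ 0 * exp (-(r - R)))))
      atTop (𝓝 (-(0 + (2 * R + 4) * 0 + (R ^ 2 + 6 * R + 8) * 0 +
        (2 * R ^ 2 + 6 * R + 8) * 0))) :=
    ((((hn 3).add ((hn 2).const_mul _)).add ((hn 1).const_mul _)).add ((hn 0).const_mul _)).neg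
  simp only [mul_zero, add_zero, neg_zero] at h
  refine h.congr fun r => ?_
  ring

/-- The tail integral `∫_R^∞ (1 + (r-R)) e^{-(r-R)} r² dr = 2R² + 6R + 8`. [folklore] -/
theorem integral_tail (R : ℝ) :
    ∫ r in Ioi R, (1 + (r - R)) * exp (-(r - R)) * r ^ 2 = 2 * R ^ 2 + 6 * R + 8 := by
  rw [integral_Ioi_of_hasDerivAt_of_nonneg' (fun r _ => hasDerivAt_tailPrim R r)
    (fun r hr => mul_nonneg (mul_nonneg (by linarith [mem_Ioi.1 hr]) (exp_pos _).le)
      (sq_nonneg r)) (tendsto_tailPrim R)]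
  simp

/-- Integrability of the tail integrand. [folklore] -/
theorem integrableOn_tail (R : ℝ) :
    IntegrableOn (fun r => (1 + (r - R)) * exp (-(r - R)) * r ^ 2) (Ioi R) :=
  integrableOn_Ioi_deriv_of_nonneg' (fun r _ => hasDerivAt_tailPrim R r)
    (fun r hr => mul_nonneg (mul_nonneg (by linarith [mem_Ioi.1 hr]) (exp_pos _).le)
      (sq_nonneg r)) (tendsto_tailPrim R)

/-- The radial integral of the deficiency:
`∫_0^∞ (1 + (r-R)₊) e^{-(r-R)₊} r² dr ≤ R³/3 + 2R² + 6R + 8` (`R ≥ 0`; in `ℝ≥0∞`, an equality: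
core `∫₀^R r² = R³/3` plus the tail). [folklore] -/
theorem lintegral_radial_deficiency_le {R : ℝ} (hR : 0 ≤ R) :
    ∫⁻ r in Ioi (0 : ℝ), ENNReal.ofReal ((1 + max (r - R) 0) * exp (-max (r - R) 0)) *
        ENNReal.ofReal (r ^ 2) ≤ ENNReal.ofReal (R ^ 3 / 3 + 2 * R ^ 2 + 6 * R + 8) := by
  have hmeas : MeasurableSet (Ioi R) := measurableSet_Ioi
  rw [← Ioc_union_Ioi_eq_Ioi hR, lintegral_union hmeas (Ioc_disjoint_Ioi le_rfl)]
  have h1 : ∫⁻ r in Ioc (0 : ℝ) R,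
      ENNReal.ofReal ((1 + max (r - R) 0) * exp (-max (r - R) 0)) * ENNReal.ofReal (r ^ 2) =
        ENNReal.ofReal (R ^ 3 / 3) := by
    have hc : ∀ r ∈ Ioc (0 : ℝ) R,
        ENNReal.ofReal ((1 + max (r - R) 0) * exp (-max (r - R) 0)) * ENNReal.ofReal (r ^ 2) =
          ENNReal.ofReal (r ^ 2) := by
      intro r hr
      rw [max_eq_right (by linarith [hr.2]), neg_zero, exp_zero, add_zero, one_mul,
        ENNReal.ofReal_one, one_mul]
    rw [setLIntegral_congr_fun measurableSet_Ioc hc, ← ofReal_integral_eq_lintegral_ofReal]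
    · rw [← intervalIntegral.integral_of_le hR, integral_pow]
      congr 1; ring
    · exact (continuous_pow 2).integrableOn_Ioc
    · exact ae_of_all _ fun r => sq_nonneg r
  have h2 : ∫⁻ r in Ioi R,
      ENNReal.ofReal ((1 + max (r - R) 0) * exp (-max (r - R) 0)) * ENNReal.ofReal (r ^ 2) =
        ENNReal.ofReal (2 * R ^ 2 + 6 * R + 8) := by
    have hc : ∀ r ∈ Ioi R,
        ENNReal.ofReal ((1 + max (r - R) 0) * exp (-max (r - R) 0)) * ENNReal.ofReal (r ^ 2) =
          ENNReal.ofReal ((1 + (r - R)) * exp (-(r - R)) * r ^ 2) := by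
      intro r hr
      rw [max_eq_left (by linarith [mem_Ioi.1 hr]), ← ENNReal.ofReal_mul (by
        have : 0 ≤ r - R := by linarith [mem_Ioi.1 hr]
        positivity)]
    rw [setLIntegral_congr_fun hmeas hc,
      ← ofReal_integral_eq_lintegral_ofReal (integrableOn_tail R), integral_tail R]
    refine ae_restrict_of_forall_mem hmeas fun r hr => ?_
    have : 0 ≤ r - R := by linarith [mem_Ioi.1 hr]
    positivity
  rw [h1, h2, ← ENNReal.ofReal_add (by positivity) (by positivity)]
  refine ENNReal.ofReal_le_ofReal (le_of_eq ?_)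
  ring

/-- `σ(S²) = 4π` for Lebesgue measure on `ℝ³` (`σ(S²) = 3 · vol(B₁) = 3 · 4π/3`). [folklore] -/
theorem toSphere_univ_eq :
    (volume : Measure (EuclideanSpace ℝ (Fin 3))).toSphere univ = ENNReal.ofReal (4 * π) := by
  rw [Measure.toSphere_apply_univ, finrank_euclideanSpace_fin,
    EuclideanSpace.volume_ball_fin_three, ENNReal.ofReal_one, one_pow, one_mul,
    show ((3 : ℕ) : ℝ≥0∞) = ENNReal.ofReal 3 by norm_num, ← ENNReal.ofReal_mul (by norm_num)]
  congr 1; ring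

/-- **Jastrow volume of the exponential profile**: for `R ≥ 0`,
`∫_{ℝ³} (1 + (‖z‖-R)₊) e^{-(‖z‖-R)₊} dz ≤ 4π (R³/3 + 2R² + 6R + 8)` (polar coordinates; an
equality). This is `∫ (1 - f)` for the Jastrow profile
`f(z) = 1 - (1 + (‖z‖-R)₊)e^{-(‖z‖-R)₊}`. [folklore] -/
theorem lintegral_deficiency_le {R : ℝ} (hR : 0 ≤ R) :
    ∫⁻ z : EuclideanSpace ℝ (Fin 3),
        ENNReal.ofReal ((1 + max (‖z‖ - R) 0) * exp (-max (‖z‖ - R) 0)) ≤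
      ENNReal.ofReal (4 * π * (R ^ 3 / 3 + 2 * R ^ 2 + 6 * R + 8)) := by
  have hmeas : Measurable fun r : ℝ =>
      ENNReal.ofReal ((1 + max (r - R) 0) * exp (-max (r - R) 0)) :=
    (by fun_prop : Continuous fun r : ℝ =>
      (1 + max (r - R) 0) * exp (-max (r - R) 0)).measurable.ennreal_ofReal
  refine (le_of_eq (Literature.Analysis.Calculus.lintegral_radial_eq
    (fun r => ENNReal.ofReal ((1 + max (r - R) 0) * exp (-max (r - R) 0))) hmeas)).trans ?_
  rw [toSphere_univ_eq, ENNReal.ofReal_mul (p := 4 * π) (by positivity)]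
  exact mul_le_mul' le_rfl (lintegral_radial_deficiency_le hR)

/-! ### Scale covariance of the insertion bound -/

/-- The scaled potential `s⁻²v(·/s)` is measurable. [folklore] -/
theorem measurable_scalePotential {v : ℝ → ℝ≥0∞} (hv : Measurable v) (s : ℝ) :
    Measurable (scalePotential s v) :=
  (hv.comp (measurable_id.const_mul s⁻¹)).const_mul _

/-- The scaled potential of a potential of range `R₀` has range `s R₀` (`s > 0`). [folklore] -/
theorem scalePotential_eq_zero_of_lt {v : ℝ → ℝ≥0∞} {R₀ s : ℝ} (hs : 0 < s)
    (hv : ∀ r, R₀ < r → v r = 0) {r : ℝ} (hr : s * R₀ < r) : scalePotential s v r = 0 := by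
  rw [scalePotential_apply, hv _ ((lt_inv_mul_iff₀ hs).2 hr), mul_zero]

/-- **Scale covariance of the insertion bound.** A bound
`E₀(N+1, L) ≤ E₀(N, L) + A/L² + B·N·c/L³` for all measurable potentials of ONE fixed range
`c > 0` (at density `N c³ ≤ L³/2000`) implies the same bound with `c` replaced by the range
`R₀` of an arbitrary finite-range potential: dilate space by `s = c/R₀`
(`E₀(s⁻²v(·/s), N, sL) = s⁻² E₀(v, N, L)`, `JelliumBoseGas.groundStateEnergy_dilate`); both
sides scale like `s⁻²`. [folklore] -/
theorem insertionBound_of_fixedRange {c A B : ℝ} (hc : 0 < c)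
    (h : ∀ (v : ℝ → ℝ≥0∞), Measurable v → (∀ r, c < r → v r = 0) →
      ∀ (N : ℕ) (L : ℝ), 0 < L → (N : ℝ) * c ^ 3 ≤ L ^ 3 / 2000 →
        groundStateEnergy v (N + 1) L ≤
          groundStateEnergy v N L + ENNReal.ofReal (A / L ^ 2 + B * N * c / L ^ 3))
    {v : ℝ → ℝ≥0∞} (hv : Measurable v) {R₀ : ℝ} (hR₀ : 0 < R₀)
    (hvR : ∀ r, R₀ < r → v r = 0) (N : ℕ) {L : ℝ} (hL : 0 < L)
    (hNL : (N : ℝ) * R₀ ^ 3 ≤ L ^ 3 / 2000) :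
    groundStateEnergy v (N + 1) L ≤
      groundStateEnergy v N L + ENNReal.ofReal (A / L ^ 2 + B * N * R₀ / L ^ 3) := by
  set s : ℝ := c / R₀ with hs_def
  have hs : 0 < s := div_pos hc hR₀
  have hsR : s * R₀ = c := div_mul_cancel₀ c hR₀.ne'
  have hdens : (N : ℝ) * c ^ 3 ≤ (s * L) ^ 3 / 2000 := by
    rw [← hsR]
    calc (N : ℝ) * (s * R₀) ^ 3 = s ^ 3 * ((N : ℝ) * R₀ ^ 3) := by ring
      _ ≤ s ^ 3 * (L ^ 3 / 2000) := by gcongr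
      _ = (s * L) ^ 3 / 2000 := by ring
  have h1 := h (scalePotential s v) (measurable_scalePotential hv s)
    (fun r hr => scalePotential_eq_zero_of_lt hs hvR (by rwa [hsR])) N (s * L) (mul_pos hs hL)
    hdens
  rw [JelliumBoseGas.groundStateEnergy_dilate _ _ _ hs,
    JelliumBoseGas.groundStateEnergy_dilate _ _ _ hs] at h1
  have hX : A / (s * L) ^ 2 + B * N * c / (s * L) ^ 3 =
      (s ^ 2)⁻¹ * (A / L ^ 2 + B * N * R₀ / L ^ 3) := by
    rw [← hsR]; field_simp
  rw [hX, ENNReal.ofReal_mul (by positivity), ← mul_add] at h1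
  exact (ENNReal.mul_le_mul_iff_right (ENNReal.ofReal_pos.2 (by positivity)).ne'
    ENNReal.ofReal_ne_top).1 h1

/-! ### Cancelling the mass in the insertion bound -/

/-- **Cancelling the mass.** From `E₁ M ≤ E M + c + 9w`, `1 ≤ M + 2w`, `M ≤ 1`, `w ≤ w₀`
and `2w₀ < 1`: `E₁ ≤ E + (c + 9w₀)/(1 - 2w₀)` (all in `ℝ≥0∞`). [folklore] -/
theorem final_bound {E₁ E M c w w₀ : ℝ≥0∞} (hfloor : E₁ * M ≤ E * M + c + 9 * w)
    (hlow : 1 ≤ M + 2 * w) (hM1 : M ≤ 1) (hw : w ≤ w₀) (hw₀ : 2 * w₀ < 1) :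
    E₁ ≤ E + (c + 9 * w₀) / (1 - 2 * w₀) := by
  have hm : 1 - 2 * w₀ ≤ M := by
    have : 1 ≤ M + 2 * w₀ := hlow.trans (add_le_add le_rfl (mul_le_mul' le_rfl hw))
    exact tsub_le_iff_right.2 this
  have hm0 : 1 - 2 * w₀ ≠ 0 := (tsub_pos_of_lt hw₀).ne'
  have hM0 : M ≠ 0 := by
    intro h
    rw [h, nonpos_iff_eq_zero] at hm
    exact hm0 hm
  have hMtop : M ≠ ⊤ := ne_top_of_le_ne_top ENNReal.one_ne_top hM1
  have h1 : E₁ * M ≤ E * M + (c + 9 * w₀) :=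
    hfloor.trans (by rw [add_assoc]; gcongr)
  have h2 : E₁ * M ≤ (E + (c + 9 * w₀) / M) * M := by
    rw [add_mul, ENNReal.div_mul_cancel hM0 hMtop]; exact h1
  have h3 : E₁ ≤ E + (c + 9 * w₀) / M := (ENNReal.mul_le_mul_iff_left hM0 hMtop).1 h2
  exact h3.trans (add_le_add le_rfl (ENNReal.div_le_div_left hm _))

/-- **Cancelling the mass, real form**: with real majorants `c ≤ c'`, `w ≤ w'`, `2w' < 1`,
`E₁ ≤ E + ((c' + 9w')/(1 - 2w'))`. [folklore] -/
theorem final_bound_real {E₁ E M c w : ℝ≥0∞} {c' w' : ℝ}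
    (hfloor : E₁ * M ≤ E * M + c + 9 * w) (hlow : 1 ≤ M + 2 * w) (hM1 : M ≤ 1)
    (hc : c ≤ ENNReal.ofReal c') (hw : w ≤ ENNReal.ofReal w') (hc' : 0 ≤ c') (hw' : 0 ≤ w')
    (h2 : 2 * w' < 1) : E₁ ≤ E + ENNReal.ofReal ((c' + 9 * w') / (1 - 2 * w')) := by
  have hfloor' : E₁ * M ≤ E * M + ENNReal.ofReal c' + 9 * w := hfloor.trans (by gcongr)
  have hw₀ : 2 * ENNReal.ofReal w' < 1 := by
    rw [← ENNReal.ofReal_ofNat, ← ENNReal.ofReal_mul (by norm_num), ← ENNReal.ofReal_one]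
    exact (ENNReal.ofReal_lt_ofReal_iff one_pos).2 h2
  refine (final_bound hfloor' hlow hM1 hw hw₀).trans (add_le_add le_rfl (le_of_eq ?_))
  rw [ENNReal.ofReal_div_of_pos (by linarith), ENNReal.ofReal_add hc' (by positivity),
    ENNReal.ofReal_mul (by norm_num), ENNReal.ofReal_sub _ (by positivity),
    ENNReal.ofReal_mul (by norm_num), ENNReal.ofReal_one, ENNReal.ofReal_ofNat,
    ENNReal.ofReal_ofNat]

end InsertionScaling

end Literature.MathematicalPhysics.QuantumManyBody.BoseGas

end
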